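import Summits.BirchSwinnertonDyer.BirchSwinnertonDyer.Theorems.ByReductionTypeAtTwoTowerLayerUpper
import HarnessLib

/-!
# The item `OrdKatoHalfAtTwo` AT `W` from the GAP certificate ALONE (decidable kernel data, one or two
# layer counts): no `λ_an`, no `μ_an`, no rank certificate, no Prop. 4.14, no `MissingLowerBoundAt`,
# any analytic rank (route ByReductionTypeAtTwo, crux `OrdKatoHalfAtTwo`, items
# stmt-BirchSwinnertonDyer-19271 / 19573; seat bsd-2adic-tower-1 GEN 2, part 12)

HONEST FRAMING (cell `bsd-2adic`, run/shared/lean/pub/bsd-2adic/, HUMAN RULINGS D-0036/D-0074): THEOREMS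
ONLY; nothing asserted; no definition; no new named fact; closes nothing by itself.

Parts 7–11 routed the item AT `W` (`O1.MainConjectureLowerDivisibilityAtTwoOrd W` = Kato's INTEGRAL
divisibility `char_Λ X ∣ ϖ·L₂` at `W`) through the `λ`-road (`hrank`, `λ_an = n`, `μ_an = 0`, Prop. 4.14).
That is unnecessary: the gap certificate gives `X` torsion with `μ = 0` (T10), and `μ = 0` alone
upgrades Kato 17.4 (1)(2)@2 from `Λ[1/2]` to `Λ` — tree `O1.mainConjectureLowerDivisibilityAtTwoOrd_of_towerGapAtTwo`
(X5, `KatoOrdTwoTowerGapIff`; used the same way by ord-2's `katoHalfAt_two_of_levelOne_counts`), with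
the Néron certificate `hper₀` turned into `ι L₀ = ϖ·L₂` by `O1.exists_integral_mul_padicLFunction_two_of_padicValRat_nonneg`.
Doors: `katoHalfAt_two_of_layerSelmer_cert_gap` (two layer counts) and
`katoHalfAt_two_of_layerSelmer_cert_upper_gap` (ONE layer count): PRINT {Kato 17.4 (1)(2)@2 `h17`,
Greenberg L.3.3@2 readings `h33g`/`hM`/`hA`, L.3.4@2 structure `hS34`} + CERTIFICATES {`hper₀`, odd
torsion, decidable `P`/`C`/`e`/`k` data, the layer count(s), the closed arithmetic}. These are the
minimal per-class forms of items 19271 (AT `W`) / 19573 (AT a member; compose with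
`mainConjectureLowerDivisibilityAtTwoOrd_of_isIsogenous` where needed).

References: K. Kato, Astérisque 295 (2004), Thm. 17.4; R. Greenberg, LNM 1716 (1999), §3;
Mazur–Tate–Teitelbaum (1986), §I.12.
-/

set_option autoImplicit false

noncomputable section

open scoped Classical MatrixGroups ModularForm

open NumberField IsDedekindDomain CongruenceSubgroup WeierstrassCurve Literature.NumberTheory.EllipticCurves
  Literature.NumberTheory.EllipticCurves.ModularForms Literature.NumberTheory.EllipticCurves.Rank1Residual
  Literature.NumberTheory.EllipticCurves.Rank1Residual.Typed
  Literature.NumberTheory.EllipticCurves.Greenberg1999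
  Summit.BirchSwinnertonDyer.Rank1Residual.X1.MuLambda
  Summit.BirchSwinnertonDyer.Rank1Residual.X1.MuPart
  Summit.BirchSwinnertonDyer.Rank1Residual.X1.ParitySqueeze
  Summit.BirchSwinnertonDyer.BirchSwinnertonDyer.Theorems.Rank1ResidualX1Defs
  Summit.BirchSwinnertonDyer.Rank1Residual.X5 Summit.BirchSwinnertonDyer.Rank1Residual.X5.O1
  Summit.BirchSwinnertonDyer.Rank1Residual.X5.TowerGap
  Summit.BirchSwinnertonDyer.Rank1Residual

namespace Summit.BirchSwinnertonDyer.BirchSwinnertonDyer.Theorems.KatoHalfPinch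

section Curve

variable (W : WeierstrassCurve ℚ) [W.IsElliptic] [W.IsGloballyMinimal]

/-- **The item AT `W` from any gap certificate** (bookkeeping): Kato 17.4 (1)(2)@2 + Néron integrality
`hper₀` + good ordinary `2` + `O1.TowerGapAtTwo W` ⇒ `O1.MainConjectureLowerDivisibilityAtTwoOrd W`.
[cite: Kato2004Asterisque, Thm. 17.4 (1)(2) (p. 273)] [cite: MazurTateTeitelbaum1986Invent, §I.12] -/
theorem katoHalfAt_two_of_towerGap_of_neron
    (h17 : ∀ [NeZero (W.conductorNorm ℤ)] (f : CuspForm (Gamma0 (W.conductorNorm ℤ)) 2),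
      kato_divisibility_allPrimes W 2 (f := f))
    (hper₀ : ∀ [NeZero (W.conductorNorm ℤ)] (f : CuspForm (Gamma0 (W.conductorNorm ℤ)) 2),
      IsNewformOf W f → ∀ ϖ : ℚ, (ϖ : ℝ) * W.realPeriodRat = plusPeriod f → 0 ≤ padicValRat 2 ϖ)
    (hgo : GoodOrd W 2) (hgap : TowerGapAtTwo W) : MainConjectureLowerDivisibilityAtTwoOrd W := by
  have hord : IsOrdinaryAt W 2 := hgo
  refine mainConjectureLowerDivisibilityAtTwoOrd_of_towerGapAtTwo W h17 ?_ hgap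
  intro _ f hf ϖ hϖ
  exact exists_integral_mul_padicLFunction_two_of_padicValRat_nonneg W hord hf (hper₀ f hf ϖ hϖ)

/-- **The item `OrdKatoHalfAtTwo` AT `W` from the GAP certificate alone (two layer counts, decidable
kernel data).** PRINT: `h17`, `h33g`, `hM`, `hA`, `hS34`. CERTIFICATES: `hper₀`; odd torsion; `P`/`hP`/
`hΔ`; `C`, `e`, `k` with `he`, `hC`; `2^a ≤ #Sel_{2^∞}(E/ℚ_j)[2]`, `#Sel_{2^∞}(E/ℚ_{j'})[2] ≤ 2^d`;
`2^d · 4 · ∏_{ℓ ∈ P} C_ℓ^{2^{min(j', e_ℓ)}} < 2^{2^{j'} − 2^j + a}`. No `λ_an`/`μ_an`/`hrank`/Prop 4.14,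
any analytic rank. [cite: Kato2004Asterisque, Thm. 17.4 (1)(2) (p. 273)]
[cite: GreenbergLNM1716, §3 Lemmas 3.3–3.5 (PDF pp. 86–90), Prop. 2.5] -/
theorem katoHalfAt_two_of_layerSelmer_cert_gap
    (h17 : ∀ [NeZero (W.conductorNorm ℤ)] (f : CuspForm (Gamma0 (W.conductorNorm ℤ)) 2),
      kato_divisibility_allPrimes W 2 (f := f))
    (h33g : lemma33_localTowerKerPrimary_eq_bot_of_good.{0})
    (hM : lemma33_localTowerKerPrimary_cyclic_of_multiplicative.{0})
    (hA : lemma33_natCard_localTowerKerPrimary_le_four_of_additive.{0})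
    (hS34 : lemma34_localTowerKerPrimary_cyclicExtension_rat)
    (hper₀ : ∀ [NeZero (W.conductorNorm ℤ)] (f : CuspForm (Gamma0 (W.conductorNorm ℤ)) 2),
      IsNewformOf W f → ∀ ϖ : ℚ, (ϖ : ℝ) * W.realPeriodRat = plusPeriod f → 0 ≤ padicValRat 2 ϖ)
    (hgo : GoodOrd W 2) (htors : ¬ 2 ∣ W.torsionOrder) {j j' a d : ℕ} (hjj' : j ≤ j')
    (P : Finset ℕ) (hP : ∀ ℓ ∈ P, ℓ.Prime ∧ ℓ ≠ 2)
    (hΔ : ∀ ℓ : ℕ, ℓ.Prime → ℓ ≠ 2 → (ℓ : ℤ) ∣ W.minimalDiscriminantInt → ℓ ∈ P)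
    (C e k : ℕ → ℕ) (he : ∀ ℓ ∈ P, ¬ 2 ^ (e ℓ + 4) ∣ ℓ ^ 2 - 1)
    (hC : ∀ (ℓ : ℕ) [Fact ℓ.Prime], ℓ ∈ P →
      4 ≤ C ℓ ∨ (W.HasMultiplicativeReductionAtPrime ℓ ∧ 2 ≤ C ℓ) ∨
        (W.HasMultiplicativeReductionAtPrime ℓ ∧ (ℓ : ℤ) ^ k ℓ ∣ W.minimalDiscriminantInt ∧
          ¬ (ℓ : ℤ) ^ (k ℓ + 1) ∣ W.minimalDiscriminantInt ∧ ¬ 2 ∣ k ℓ ∧ 1 ≤ C ℓ) ∨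
        (¬ (ℓ : ℤ) ∣ W.minimalDiscriminantInt ∧ 1 ≤ C ℓ))
    (hlow : ∀ κ : ZpExtension ℚ 2, κ.IsCyclotomic →
      2 ^ a ≤ Nat.card {z : W.selmerLayer κ j // 2 • z = 0})
    (hup : ∀ κ : ZpExtension ℚ 2, κ.IsCyclotomic →
      Nat.card {z : W.selmerLayer κ j' // 2 • z = 0} ≤ 2 ^ d)
    (harith : 2 ^ d * 4 * ∏ ℓ ∈ P, C ℓ ^ 2 ^ min j' (e ℓ) < 2 ^ (2 ^ j' - 2 ^ j + a)) :
    MainConjectureLowerDivisibilityAtTwoOrd W :=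
  katoHalfAt_two_of_towerGap_of_neron W h17 hper₀ hgo
    (towerGapAtTwo_of_layerSelmer_cert W h33g hM hA hS34 hgo htors hjj' P hP hΔ C e k he hC hlow hup
      harith)

/-- **The item `OrdKatoHalfAtTwo` AT `W` from ONE layer count** (decidable kernel data): as
`katoHalfAt_two_of_layerSelmer_cert_gap` with the lower count dropped (part 11) and the arithmetic
`2^d · 4 · ∏_{ℓ ∈ P} C_ℓ^{2^{min(j', e_ℓ)}} < 2^{2^{j'} − 1}`. [cite: Kato2004Asterisque, Thm. 17.4 (1)(2) (p. 273)]
[cite: GreenbergLNM1716, §3 Lemmas 3.1, 3.3–3.5, Prop. 2.5] -/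
theorem katoHalfAt_two_of_layerSelmer_cert_upper_gap
    (h17 : ∀ [NeZero (W.conductorNorm ℤ)] (f : CuspForm (Gamma0 (W.conductorNorm ℤ)) 2),
      kato_divisibility_allPrimes W 2 (f := f))
    (h33g : lemma33_localTowerKerPrimary_eq_bot_of_good.{0})
    (hM : lemma33_localTowerKerPrimary_cyclic_of_multiplicative.{0})
    (hA : lemma33_natCard_localTowerKerPrimary_le_four_of_additive.{0})
    (hS34 : lemma34_localTowerKerPrimary_cyclicExtension_rat)
    (hper₀ : ∀ [NeZero (W.conductorNorm ℤ)] (f : CuspForm (Gamma0 (W.conductorNorm ℤ)) 2),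
      IsNewformOf W f → ∀ ϖ : ℚ, (ϖ : ℝ) * W.realPeriodRat = plusPeriod f → 0 ≤ padicValRat 2 ϖ)
    (hgo : GoodOrd W 2) (htors : ¬ 2 ∣ W.torsionOrder) {j' d : ℕ}
    (P : Finset ℕ) (hP : ∀ ℓ ∈ P, ℓ.Prime ∧ ℓ ≠ 2)
    (hΔ : ∀ ℓ : ℕ, ℓ.Prime → ℓ ≠ 2 → (ℓ : ℤ) ∣ W.minimalDiscriminantInt → ℓ ∈ P)
    (C e k : ℕ → ℕ) (he : ∀ ℓ ∈ P, ¬ 2 ^ (e ℓ + 4) ∣ ℓ ^ 2 - 1)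
    (hC : ∀ (ℓ : ℕ) [Fact ℓ.Prime], ℓ ∈ P →
      4 ≤ C ℓ ∨ (W.HasMultiplicativeReductionAtPrime ℓ ∧ 2 ≤ C ℓ) ∨
        (W.HasMultiplicativeReductionAtPrime ℓ ∧ (ℓ : ℤ) ^ k ℓ ∣ W.minimalDiscriminantInt ∧
          ¬ (ℓ : ℤ) ^ (k ℓ + 1) ∣ W.minimalDiscriminantInt ∧ ¬ 2 ∣ k ℓ ∧ 1 ≤ C ℓ) ∨
        (¬ (ℓ : ℤ) ∣ W.minimalDiscriminantInt ∧ 1 ≤ C ℓ))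
    (hup : ∀ κ : ZpExtension ℚ 2, κ.IsCyclotomic →
      Nat.card {z : W.selmerLayer κ j' // 2 • z = 0} ≤ 2 ^ d)
    (harith : 2 ^ d * 4 * ∏ ℓ ∈ P, C ℓ ^ 2 ^ min j' (e ℓ) < 2 ^ (2 ^ j' - 1)) :
    MainConjectureLowerDivisibilityAtTwoOrd W :=
  katoHalfAt_two_of_towerGap_of_neron W h17 hper₀ hgo
    (towerGapAtTwo_of_layerSelmer_cert_upper W h33g hM hA hS34 hgo htors P hP hΔ C e k he hC hup harith)

end Curve

end Summit.BirchSwinnertonDyer.BirchSwinnertonDyer.Theorems.KatoHalfPinch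

end
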